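/-
Copyright (c) 2026 the pub-hodgecm-mathlib formalisation cell (harness21).  Prover seat hodgecm-mathlib-B-p14 (g30), (F11) LAYER B′ FILE 3 (i): the entries of
`h⁻¹ t h` in the `2×2` model of `Stab(w₀)` (DESIGN v3 §FILE 3; architect A-p06 (g26); FILES 1–2 A-p13 (g30)), 2026-09-01.
-/
import Literature.NumberTheory.Automorphic.UnitaryThreeAnisotropicStabilizerBounds   -- ★ p841597/p841626 (this seat): frame, (U1)–(U3), exponent `N`
import HarnessLib

/-!
# Flicker's Proposition 16, step (i): the two `H′_m`-coordinates of `h⁻¹ t h` in the `2×2` model `M_h = [[A, q],[ρ, s]]` of the anisotropic stabiliser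
# (Flicker 1998, Prop. 16 p. 96 — the matrix identity displayed in its proof)

Topic `NumberTheory/Automorphic`; namespace `Literature.NumberTheory.Automorphic.UnitaryGroup`.  THEOREMS ONLY; pure `2×2` algebra over a field with a ring
endomorphism `σ` (no valuation needed), so that FILE 3 (ii) (valuation regimes) and A-p13's FILE 2 (cosets) can both read it.  Cell `pub/hodgecm-mathlib`, crux H413,
line «N7nsCount», value stub `stub_irredGValueNeg` (κ = −1), LAYER B′ = Prop. 16's count; DESIGN v3 `F0/P3a/B-p14/g30/DESIGN-F11c-LayerBprime-step2.B-p14g30.md`.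

For `M_h = !![A, q; ρ, s]` with `Δ := A·s − ρ·q ≠ 0` and `M_t = !![A_t, q_t; ρ_t, s_t]`, writing `M_h⁻¹ = Δ⁻¹·!![s, −q; −ρ, A]` (`adjugate_mul_model`):
* `conj_model_entry01`: **`(M_h⁻¹ M_t M_h)₀₁ = Δ⁻¹·((A_t − s_t)·s·q + q_t·s² − ρ_t·q²)`** — the `q`-coordinate of `h⁻¹th` (condition «`|·| ≤ |ϖ|^m`»);
* `conj_model_entry00`: **`(M_h⁻¹ M_t M_h)₀₀ = Δ⁻¹·(s·(A_t·A + q_t·ρ) − q·(ρ_t·A + s_t·ρ))`** — the `A`-coordinate (condition «`|· − 1| ≤ |ϖ|^{2m+1}`»);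
* `conj_model_entry00_sub_one_of_unitarity`: under the UNITARITY dictionary of ★ FILE 1∕Bounds — `Δ = A∕σs`, `ρ = −4ϖ·A·σq∕σs`, `ρ_t = −4ϖ·A_t·σq_t∕σs_t`,
  `σs·s + 4ϖ·σq·q = 1` — the `A`-coordinate minus one equals **`(A_t − 1) − 4ϖ·(A_t − s_t)·(σq·q) − 4ϖ·(X − Δ_t·σX)`**, `X := q_t·σq·s`, `Δ_t := A_t∕σs_t`,
  `σX = σq_t·q·σs` (`σ² = 1`) — the form from which Prop. 16's three regimes are read (DESIGN v3).
HONEST LABEL: HC_CM is proved only modulo the printed citations until rung 0 closes; algebra feeding ONE value stub of #103-ns.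

## References
* [Flicker1998UnitaryFL] Y. Z. Flicker, *Elementary proof of the fundamental lemma for a unitary group*, Canad. J. Math. 50 (1998), Prop. 16 p. 96 (proof, displayed identity).
-/

set_option autoImplicit false

open Matrix

namespace Literature.NumberTheory.Automorphic

namespace UnitaryGroup

variable {K : Type*} [Field K]

/-- The adjugate formula in the model: `(Δ⁻¹·!![s, −q; −ρ, A]) · !![A, q; ρ, s] = 1` for `Δ = As − ρq ≠ 0` — so the left factor IS `M_h⁻¹`.
[cite: Flicker1998UnitaryFL, Prop. 16 p. 96] -/
theorem adjugate_mul_model {A q ρ s : K} (hΔ : A * s - ρ * q ≠ 0) :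
    ((A * s - ρ * q)⁻¹ • !![s, -q; -ρ, A] : Matrix (Fin 2) (Fin 2) K) * !![A, q; ρ, s] = 1 := by
  ext i j
  fin_cases i <;> fin_cases j <;> simp [Matrix.mul_apply, Fin.sum_univ_two] <;> field_simp <;> ring

/-- The model inverse is the adjugate one: `(!![A, q; ρ, s])⁻¹ = Δ⁻¹·!![s, −q; −ρ, A]`. [cite: Flicker1998UnitaryFL, Prop. 16 p. 96] -/
theorem model_inv_eq {A q ρ s : K} (hΔ : A * s - ρ * q ≠ 0) :
    (!![A, q; ρ, s] : Matrix (Fin 2) (Fin 2) K)⁻¹ = (A * s - ρ * q)⁻¹ • !![s, -q; -ρ, A] :=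
  Matrix.inv_eq_left_inv (adjugate_mul_model hΔ)

/-- **The `q`-coordinate of `h⁻¹ t h`**: `(M_h⁻¹ M_t M_h)₀₁ = Δ⁻¹·((A_t − s_t)·s·q + q_t·s² − ρ_t·q²)`. [cite: Flicker1998UnitaryFL, Prop. 16 p. 96] -/
theorem conj_model_entry01 (A q ρ s At qt ρt st : K) :
    (((A * s - ρ * q)⁻¹ • !![s, -q; -ρ, A] : Matrix (Fin 2) (Fin 2) K) * !![At, qt; ρt, st] * !![A, q; ρ, s]) 0 1 =
      (A * s - ρ * q)⁻¹ * ((At - st) * s * q + qt * s ^ 2 - ρt * q ^ 2) := by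
  simp [Matrix.mul_apply, Fin.sum_univ_two]
  ring

/-- **The `A`-coordinate of `h⁻¹ t h`**: `(M_h⁻¹ M_t M_h)₀₀ = Δ⁻¹·(s·(A_t A + q_t ρ) − q·(ρ_t A + s_t ρ))`. [cite: Flicker1998UnitaryFL, Prop. 16 p. 96] -/
theorem conj_model_entry00 (A q ρ s At qt ρt st : K) :
    (((A * s - ρ * q)⁻¹ • !![s, -q; -ρ, A] : Matrix (Fin 2) (Fin 2) K) * !![At, qt; ρt, st] * !![A, q; ρ, s]) 0 0 =
      (A * s - ρ * q)⁻¹ * (s * (At * A + qt * ρ) - q * (ρt * A + st * ρ)) := by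
  simp [Matrix.mul_apply, Fin.sum_univ_two]
  ring

/-- **The `A`-coordinate minus one, under the unitarity dictionary** (`σ² = 1`, `Δ = A∕σs`, `ρ = −4ϖAσq∕σs`, `ρ_t = −4ϖA_tσq_t∕σs_t`, `σs·s + 4ϖ·σq·q = 1`):
`Δ⁻¹·(s(A_tA + q_tρ) − q(ρ_tA + s_tρ)) − 1 = (A_t − 1) − 4ϖ(A_t − s_t)(σq·q) − 4ϖ(X − Δ_t σX)`, `X = q_t·σq·s`, `σX = σq_t·q·σs`, `Δ_t = A_t∕σs_t` — the form read
in Prop. 16's three regimes. [cite: Flicker1998UnitaryFL, Prop. 16 p. 96] -/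
theorem conj_model_entry00_sub_one_of_unitarity (σ : K →+* K) (ϖ : K) {A q ρ s At qt ρt st : K}
    (hA : A ≠ 0) (hs : σ s ≠ 0) (hst : σ st ≠ 0)
    (hΔ : A * s - ρ * q = A / σ s) (hρ : ρ = -(4 * ϖ * A * σ q) / σ s) (hρt : ρt = -(4 * ϖ * At * σ qt) / σ st)
    (hU2 : σ s * s + 4 * ϖ * (σ q * q) = 1) :
    (A * s - ρ * q)⁻¹ * (s * (At * A + qt * ρ) - q * (ρt * A + st * ρ)) - 1 =
      (At - 1) - 4 * ϖ * (At - st) * (σ q * q) - 4 * ϖ * (qt * σ q * s - At / σ st * (σ qt * q * σ s)) := by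
  rw [hΔ, hρ, hρt]
  field_simp
  linear_combination (σ st * At) * hU2

end UnitaryGroup

end Literature.NumberTheory.Automorphic
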